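import Summits.RiemannHypothesis.RiemannHypothesis.Theorems.PfPersistenceBarrierRealPair
import HarnessLib

/-!
# PF-persistence: pole-free SUB-INDEX / FLOOR criteria are even-monotone, hence blind to a planted
real pair (PROVED, RH-free)

LONG-ODDS MECHANISM SEARCH; NO RH CLAIMS.  Value = a rigidity wall for the cell's case DAG
(`CASE-DAG.md` leaf G1.08 "pole-free spectral criteria alone: `E₁(A₀(a)) ≥ 0 ∀a`, `E_k(A₀)` floors,
soft counts of `A₀`", and the pole-free conjunct of leaf G1.21c), placing these criteria inside node
G1.SECT next to part V (`PfPersistenceBarrierRealPair`: lemma REALPAIR-MONO).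

## Schema

Fix, per cutoff `A`, a REFERENCE functional `R : (ℝ → ℂ) → ℝ` that does NOT depend on the datum, and
a codimension `k : ℕ`.  `SubIndexOn R k F A` says: there are `k` ℂ-linear functionals on tests (typed
`(ℝ → ℂ) →ₗ[ℂ] ℂ` — REPAIRED typing per adj-1 RULING A76; the first landing's arbitrary-function typing was
vacuous for `k ≥ 1`) such that
the even window form `g ↦ Re Q_F(g)` of the datum `F` dominates `R` on every even Weil test supported
in `[-A, A]` that they annihilate.  In every Galerkin model this is, by the Courant–Fischer principle
(textbook; not formalised here), the statement "the form `Re Q_F − R` has at most `k` negative levels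
on the window", i.e. `E_k(Q_F|_A − R) ≥ 0` with levels indexed from `0`.  The cell's pole-free
criteria are the instances with `R` built from the POLAR rank-one term `g ↦ 2‖⟨c_A, g⟩‖²` of `ζ`'s
even window form (`PfPersistencePolarRankOne.evenBlock_eq_poleFree_add_two_smul`: `Q = A₀ + 2|c⟩⟨c|`),
which is the same functional for every datum:

* `k = 1`, `R = polar term`: `K_pf := [E₁(A₀) ≥ 0]` (the pole-free part has exactly one negative
  level; per served window this is certified / refuted by `PfPersistencePoleFreeBracket`);
* `R = polar term − σ(A)·‖g‖²`: the floors `E_k(A₀(A)) ≥ −σ(A)`;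
* `R = polar term + τ·‖g‖²`, codimension `m`: the soft counts `#{j : E_j(A₀) < τ} ≤ m`;
* `R = −σ(A)·‖g‖²`, `k = 0`: the even ground-energy floors of G1.05-ev (`subIndexOn_zero_iff`);
  general `k`: the even signature counts of G1.17-ev.

## Results (all RH-free, elementary)

* `subIndexOn_isEvenMonotone`, `subIndex_isEvenMonotone`, `subIndexOnSet_isEvenMonotone`: every such
  criterion — at one cutoff, at all cutoffs with cutoff-dependent `R` and `k`, or along any set of
  cutoffs — is EVEN-MONOTONE in the sense of part V; `IsEvenMonotone.and` / `IsEvenMonotone.all`: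
  conjunctions and arbitrary intersections of even-monotone criteria are even-monotone (so conjoining
  pole-free floors at several levels, thresholds and cutoffs stays inside the wall);
* `realPair_of_subIndex`: a pole-free sub-index criterion holding at `ζ` holds at every planted real
  pair `realPairDatum η`;
* `no_subIndex_discriminator`, `no_subIndexOn_discriminator`, `no_subIndexOnSet_discriminator`: none of
  them discriminates `ζ` from a class of negatives containing a planted real pair (part V's
  `no_evenMonotone_discriminator`).  Negativity of the control is the binder `realPairDatum η ∈ Neg`,
  never asserted; for `ζ` itself real zeros in `(0, 1)` are excluded RH-free (door E2), which is what
  the wall says such criteria cannot measure.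
-/

noncomputable section

open MeasureTheory Set Complex
open scoped Real ComplexConjugate ContDiff

namespace Summit.RiemannHypothesis.RiemannHypothesis.Theorems.PfPersistenceBarrier

open Literature.NumberTheory.LFunctions ExplicitDatum

/-! ## The sub-index schema -/

/-- `SubIndexOn R k F A`: the even window form of `F` at cutoff `A` dominates the datum-independent
reference functional `R` on the common kernel of `k` ℂ-LINEAR functionals `ℓ i : (ℝ → ℂ) →ₗ[ℂ] ℂ`
(Galerkin reading: `E_k(Q_F|_A − R) ≥ 0`, levels from `0`).  REPAIR of record (adj-1 RULING A76,
2026-08-19): the first landing (7f6b472e567a) typed `ℓ i` as ARBITRARY functions `(ℝ → ℂ) → ℂ`, which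
made every instance with `k ≥ 1` vacuous (the constant functional `1` annihilates nothing; kernel
witness `subIndexOn_of_pos` in the A76 probe); with linear `ℓ i` the common kernel is a subspace of
finite codimension `≤ k` of the (infinite-dimensional) space of even window tests, never empty, and the
A76 witness no longer elaborates.  All proofs below are unchanged by the retyping. [folklore] -/
def SubIndexOn (R : (ℝ → ℂ) → ℝ) (k : ℕ) (F : ExplicitDatum) (A : ℝ) : Prop :=
  ∃ ℓ : Fin k → ((ℝ → ℂ) →ₗ[ℂ] ℂ), ∀ g : ℝ → ℂ, IsWeilTest g → IsEven g → tsupport g ⊆ Icc (-A) A →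
    (∀ i, ℓ i g = 0) → R g ≤ (F.quadratic g).re

/-- The all-cutoffs version with cutoff-dependent reference and codimension
(e.g. `E₁(A₀(a)) ≥ 0 ∀a`, `E_k(A₀(a)) ≥ −σ(a) ∀a`). [folklore] -/
def SubIndex (R : ℝ → (ℝ → ℂ) → ℝ) (k : ℝ → ℕ) (F : ExplicitDatum) : Prop :=
  ∀ A : ℝ, SubIndexOn (R A) (k A) F A

/-- The version along a set `S` of cutoffs (all `a ≥ a₀`, a served grid, a sequence). [folklore] -/
def SubIndexOnSet (R : ℝ → (ℝ → ℂ) → ℝ) (k : ℝ → ℕ) (S : Set ℝ) (F : ExplicitDatum) : Prop :=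
  ∀ A ∈ S, SubIndexOn (R A) (k A) F A

/-- Codimension `0` is a plain floor: `R ≤ Re Q_F` on every even Weil test in the window. [folklore] -/
theorem subIndexOn_zero_iff (R : (ℝ → ℂ) → ℝ) (F : ExplicitDatum) (A : ℝ) :
    SubIndexOn R 0 F A ↔ ∀ g : ℝ → ℂ, IsWeilTest g → IsEven g → tsupport g ⊆ Icc (-A) A →
      R g ≤ (F.quadratic g).re := by
  constructor
  · rintro ⟨ℓ, hℓ⟩ g hg he hs
    exact hℓ g hg he hs fun i ↦ i.elim0
  · intro h
    exact ⟨fun i ↦ i.elim0, fun g hg he hs _ ↦ h g hg he hs⟩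

/-- Raising the codimension weakens the criterion. [folklore] -/
theorem SubIndexOn.mono {R : (ℝ → ℂ) → ℝ} {k k' : ℕ} {F : ExplicitDatum} {A : ℝ} (h : SubIndexOn R k F A)
    (hk : k ≤ k') : SubIndexOn R k' F A := by
  obtain ⟨ℓ, hℓ⟩ := h
  refine ⟨fun i ↦ if hi : (i : ℕ) < k then ℓ ⟨i, hi⟩ else 0, fun g hg he hs h0 ↦ hℓ g hg he hs ?_⟩
  intro i
  have := h0 ⟨i, lt_of_lt_of_le i.isLt hk⟩
  simpa [i.isLt] using this

/-- Lowering the reference functional weakens the criterion. [folklore] -/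
theorem SubIndexOn.of_le {R R' : (ℝ → ℂ) → ℝ} {k : ℕ} {F : ExplicitDatum} {A : ℝ}
    (h : SubIndexOn R k F A) (hR : ∀ g, R' g ≤ R g) : SubIndexOn R' k F A := by
  obtain ⟨ℓ, hℓ⟩ := h
  exact ⟨ℓ, fun g hg he hs h0 ↦ (hR g).trans (hℓ g hg he hs h0)⟩

/-! ## Even-monotonicity -/

/-- **PROVED**: a sub-index criterion at one cutoff is even-monotone. [folklore] -/
theorem subIndexOn_isEvenMonotone (R : (ℝ → ℂ) → ℝ) (k : ℕ) (A : ℝ) :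
    IsEvenMonotone fun F ↦ SubIndexOn R k F A := by
  rintro F G hFG ⟨ℓ, hℓ⟩
  exact ⟨ℓ, fun g hg he hs h0 ↦ (hℓ g hg he hs h0).trans (hFG g hg he)⟩

/-- **PROVED**: the all-cutoffs sub-index criterion is even-monotone. [folklore] -/
theorem subIndex_isEvenMonotone (R : ℝ → (ℝ → ℂ) → ℝ) (k : ℝ → ℕ) :
    IsEvenMonotone fun F ↦ SubIndex R k F :=
  fun F G hFG hF A ↦ subIndexOn_isEvenMonotone (R A) (k A) A F G hFG (hF A)

/-- **PROVED**: the sub-index criterion along any set of cutoffs is even-monotone. [folklore] -/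
theorem subIndexOnSet_isEvenMonotone (R : ℝ → (ℝ → ℂ) → ℝ) (k : ℝ → ℕ) (S : Set ℝ) :
    IsEvenMonotone fun F ↦ SubIndexOnSet R k S F :=
  fun F G hFG hF A hA ↦ subIndexOn_isEvenMonotone (R A) (k A) A F G hFG (hF A hA)

/-- Conjunctions of even-monotone criteria are even-monotone. [folklore] -/
theorem IsEvenMonotone.and {P P' : ExplicitDatum → Prop} (hP : IsEvenMonotone P)
    (hP' : IsEvenMonotone P') : IsEvenMonotone fun F ↦ P F ∧ P' F :=
  fun F G hFG h ↦ ⟨hP F G hFG h.1, hP' F G hFG h.2⟩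

/-- Arbitrary intersections of even-monotone criteria are even-monotone. [folklore] -/
theorem IsEvenMonotone.all {ι : Sort*} {P : ι → ExplicitDatum → Prop}
    (hP : ∀ i, IsEvenMonotone (P i)) : IsEvenMonotone fun F ↦ ∀ i, P i F :=
  fun F G hFG h i ↦ hP i F G hFG (h i)

/-! ## The wall for pole-free criteria (via REALPAIR-MONO) -/

/-- **PROVED**: a pole-free sub-index criterion holding at `ζ` holds at every planted real pair. [folklore] -/
theorem realPair_of_subIndex {R : ℝ → (ℝ → ℂ) → ℝ} {k : ℝ → ℕ} (h : SubIndex R k zetaDatum) (η : ℝ) :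
    SubIndex R k (realPairDatum η) :=
  realPair_of_isEvenMonotone (subIndex_isEvenMonotone R k) h η

/-- **WALL (PROVED, RH-free)**: no all-cutoffs sub-index criterion (`E₁(A₀(a)) ≥ 0 ∀a`, pole-free
floors, soft counts of `A₀`, …) discriminates `ζ` from a class of negatives containing a planted real
pair. [folklore] -/
theorem no_subIndex_discriminator (R : ℝ → (ℝ → ℂ) → ℝ) (k : ℝ → ℕ) {Neg : Set ExplicitDatum}
    {η : ℝ} (hNeg : realPairDatum η ∈ Neg) :
    ¬ Discriminates (fun F ↦ SubIndex R k F) zetaDatum Neg :=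
  no_evenMonotone_discriminator (subIndex_isEvenMonotone R k) hNeg

/-- The same at a single cutoff. [folklore] -/
theorem no_subIndexOn_discriminator (R : (ℝ → ℂ) → ℝ) (k : ℕ) (A : ℝ) {Neg : Set ExplicitDatum}
    {η : ℝ} (hNeg : realPairDatum η ∈ Neg) :
    ¬ Discriminates (fun F ↦ SubIndexOn R k F A) zetaDatum Neg :=
  no_evenMonotone_discriminator (subIndexOn_isEvenMonotone R k A) hNeg

/-- The same along any set of cutoffs. [folklore] -/
theorem no_subIndexOnSet_discriminator (R : ℝ → (ℝ → ℂ) → ℝ) (k : ℝ → ℕ) (S : Set ℝ)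
    {Neg : Set ExplicitDatum} {η : ℝ} (hNeg : realPairDatum η ∈ Neg) :
    ¬ Discriminates (fun F ↦ SubIndexOnSet R k S F) zetaDatum Neg :=
  no_evenMonotone_discriminator (subIndexOnSet_isEvenMonotone R k S) hNeg

end Summit.RiemannHypothesis.RiemannHypothesis.Theorems.PfPersistenceBarrier

end
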